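import Literature.MathematicalPhysics.QuantumFieldTheory.Balaban1983to89.B6LapLegKLevelV1
import Literature.MathematicalPhysics.QuantumFieldTheory.Balaban1983to89.B6Ineq2140KLevelV1
import HarnessLib

/-!
# `Balaban1983to89.B6GEDVaTransposeV1` — T. Bałaban, *Propagators and renormalization transformations for lattice gauge theories. II*,
# Commun. Math. Phys. **96** (1984) 223–250 [Balaban1984PropagatorsII], Prop. 2.6 (2.136)₂,₃ p. 247: THE TRANSPOSE IDENTITY
# `(G∘∇^η*_ν)(δ_x)(x′) = (∇^η_ν∘G)(δ_{x′})(x)` for the genuine `G = Δ_a⁻¹` (symmetric kernel) — the bridge between the right entry `G∇*` of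
# p38's column-walk programme (`B6LapLegKLevelV1.DVa`) and the transposed left entry `∇G` (`B6GradLegKLevelV1.DV`) consumed by p22's
# `B6Ineq2140KLevelPadV1.ineq2140_grad_kLevel_pad_V1_of_transpose`

statement-level skeleton of published theorems with citation tags; proofs where landed; nothing here is a claim about the Yang–Mills mass gap

CITATION HEADER (lean-in-tree rule).  Phase-2 file of the `lit-balaban` typed skeleton, unit `lit-balaban-p22` (gen 23), referee ref-4, B6 fold owner r03;
SKELETON row **B6.Prop2.6** (cells only).  p38 g31's ask (3) (seat INBOX 2026-08-23T17:24:01Z).  IMPORTS BY NAME: p38's `B6LapLegKLevelV1` (`shBi`,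
`DVa`), `B6GradLegKLevelV1` (`DV`, `DV_apply`), p22's `B6Ineq2140KLevelV1.onFun_GE_single_symm` (`G† = G`, p21's `inner_GE_left`).  Three one-step
theorems: `shBi_single` (`S_ν⁻¹δ_x = δ_{x+e_ν}`), **`onFun_DVa_single_transpose`** (any `T` with a symmetric kernel), **`onFun_GE_DVa_single_transpose`** /
`onFun_DV_GE_single_transpose` (the genuine `G`).  Theorems only; no `def`, no `def … : Prop`; standard axioms.  HONEST SCOPE: pure bookkeeping, ours
(print bounds both `|(∇GJ)(x)|` and `|(G∇*J)(x)|` in (2.136) p. 247 and displays the walk (2.141) for `G`; it states no transpose identity); nothing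
analytic; NOT summit progress.  Unit `lit-balaban-p22` (gen 23), 2026-08-23.
-/

noncomputable section

namespace Literature.MathematicalPhysics.QuantumFieldTheory.Balaban1983to89.B6GEDVaTransposeV1

open LatticeFieldCalculus
open B6Ineq2133TwoScaleV1 (onFun onFun_apply)
open B6GradLegKLevelV1 (shB shB_apply DV DV_apply)
open B6LapLegKLevelV1 (shBi shBi_apply DVa DVa_apply)
open B6SectAOperatorsV1 (BondIdx)
open B6SectAVectorModelV1 (GE)
open B6Ineq2140KLevelV1 (onFun_GE_single_symm)
open B10StarCount (shift_unshift unshift_shift)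

variable {P : Params}

/-- **`S_ν⁻¹δ_x = δ_{x+e_ν}`**: the backward shift of a unit bond function is the unit bond function one fine step on.
[cite: Balaban1984PropagatorsI, (1.4) p.18; bookkeeping ours] -/
theorem shBi_single (ν : Fin P.d) (x : PBond P 0) :
    shBi ν (Pi.single x (1 : ℝ)) = Pi.single (⟨x.src.shift ν, x.dir⟩ : PBond P 0) (1 : ℝ) := by
  funext b
  rw [shBi_apply, Pi.single_apply, Pi.single_apply]
  have key : ((⟨b.src.unshift ν, b.dir⟩ : PBond P 0) = x) ↔ (b = ⟨x.src.shift ν, x.dir⟩) := by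
    constructor
    · rintro rfl
      show b = ⟨(b.src.unshift ν).shift ν, b.dir⟩
      rw [shift_unshift]
    · rintro rfl
      show (⟨(x.src.shift ν).unshift ν, x.dir⟩ : PBond P 0) = x
      rw [unshift_shift]
  simp only [key]

/-- **`(T∘∇^η*_ν)(x′, x) = (∇^η_ν∘T)(x, x′)` FOR A SYMMETRIC KERNEL `T`**: with `∇^η*_ν = c′(S_ν⁻¹ − 1)` (p38's `DVa`) acting on the INPUT and
`∇^η_ν = c′(S_ν − 1)` (p38's `DV`) acting on the OUTPUT, the entries agree after exchanging the two bonds — the transpose identity that turns a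
majorant of `∇_νG` (left entry, (2.136)₂) read on exchanged blocks into one of `G∇_ν*` (right entry, (2.136)₃) and conversely.
[cite: Balaban1984PropagatorsII, Prop. 2.6 (2.136) p.247 («|(∇GJ)(x)|, |(G∇*J)(x)|»), (2.22) p.226; Balaban1984PropagatorsI, (1.89) p.33; derivation ours] -/
theorem onFun_DVa_single_transpose (T : Module.End ℝ (PBond P 0 → ℝ)) (hT : ∀ x x' : PBond P 0, T (Pi.single x 1) x' = T (Pi.single x' 1) x)
    (ν : Fin P.d) (cf : ℝ) (x x' : PBond P 0) :
    (T ∘ₗ DVa ν cf) (Pi.single x 1) x' = (DV ν cf ∘ₗ T) (Pi.single x' 1) x := by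
  rw [LinearMap.comp_apply, LinearMap.comp_apply, DV_apply, DVa, LinearMap.smul_apply, LinearMap.sub_apply, Module.End.one_apply, map_smul,
    map_sub, shBi_single, Pi.smul_apply, Pi.sub_apply, smul_eq_mul, hT ⟨x.src.shift ν, x.dir⟩ x', hT x x']

/-- **THE GENUINE `G = Δ_a⁻¹`: `(G∘∇^η*_ν)(δ_x)(x′) = (∇^η_ν∘G)(δ_{x′})(x)`** (`G` has a symmetric kernel, `B6Ineq2140KLevelV1.onFun_GE_single_symm`) — the
hypothesis shape `∀ x x′, T′ (Pi.single x 1) x′ = (DV ν cf ∘ₗ onFun (GE …)) (Pi.single x′ 1) x` of p22's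
`B6Ineq2140KLevelPadV1.ineq2140_grad_kLevel_pad_V1_of_transpose` with `T′ := onFun (GE …) ∘ₗ DVa ν cf`.
[cite: Balaban1984PropagatorsII, Prop. 2.6 (2.136)₂,₃ p.247, (2.22) p.226 («G = Δ_a⁻¹», symmetric)] -/
theorem onFun_GE_DVa_single_transpose (Dm : B6SectADomainsV1.Domains P) {c : ℝ} (hc : c ≠ 0) {w : BondIdx Dm → ℝ} (hw : ∀ i, 0 < w i)
    (ν : Fin P.d) (cf : ℝ) (x x' : PBond P 0) :
    (onFun (GE Dm hc hw) ∘ₗ DVa ν cf) (Pi.single x 1) x' = (DV ν cf ∘ₗ onFun (GE Dm hc hw)) (Pi.single x' 1) x :=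
  onFun_DVa_single_transpose _ (onFun_GE_single_symm Dm hc hw) ν cf x x'

/-- … and the other way round: `(∇^η_ν∘G… )` — `(DV∘G)(δ_x)(x′) = (G∘DVa)(δ_{x′})(x)`. [cite: Balaban1984PropagatorsII, Prop. 2.6 (2.136)₂,₃ p.247, (2.22) p.226] -/
theorem onFun_DV_GE_single_transpose (Dm : B6SectADomainsV1.Domains P) {c : ℝ} (hc : c ≠ 0) {w : BondIdx Dm → ℝ} (hw : ∀ i, 0 < w i)
    (ν : Fin P.d) (cf : ℝ) (x x' : PBond P 0) :
    (DV ν cf ∘ₗ onFun (GE Dm hc hw)) (Pi.single x 1) x' = (onFun (GE Dm hc hw) ∘ₗ DVa ν cf) (Pi.single x' 1) x :=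
  (onFun_GE_DVa_single_transpose Dm hc hw ν cf x' x).symm

end Literature.MathematicalPhysics.QuantumFieldTheory.Balaban1983to89.B6GEDVaTransposeV1

end
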